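import Summits.Ventures.PercRepro.Night2LocalDGenCell

/-!
# PercRepro — the «partial spread» regime: bases lose, the other thin members are spread (night-2, gen 19)

`Night2LocalDGen` needed `(ρ − 2)Φ/(2 + d) ≤ capDG` so that no shadow set with `|S ∖ K| ≥ ρ + 1` is saturated.  That
fails at the `(7, 5)` cells `(3, 2)`, `(2, 1)`, `(2, 0)`.  Here the request bound for the NON-BASIS thin members
(`|B ∖ K| ≥ ρ`) is improved by a hypothesis: every such member misses at least `m₁` points of `G`
(«`m₁`-partial spread»), so it requests at most `R₁ = Φ/(m₁ + d)`; the basis members keep `R₀ = Φ/(2 + d)`.  The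
thin covering preimages of a shadow set with `|S ∖ K| ≥ ρ + 1` are non-basis members, so `L1 S ≤ (ρ − 2) R₁` there
(`L1_le_of_card_ge_dgenP`), and with `cPrimeDGP = capDG − (ρ − 2) R₁ ≥ 0` the chain of `Night2LocalDGen` goes through
unchanged: only the hyperplane-basis members lose (`loss_eq_zero_of_card_ge_dgenP`), each `≤ lambdaDG`, the loss mass
of a target is `≤ ρ C(|S ∖ K|, ρ) λ/(2^{n−ρ} − 1)` (`pi2Mass_le_dgenP`), its residual capacity `≥ cPrimeDGP`
(`cap2_ge_cPrimeDGP`) and `= 1` at the top `q − d + 1` levels.  **`localShadowHall_dgenP_of_sum`**: (LI_G) as soon as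
the generic target sum `genSum n ρ t c′ λ ≥ 1` at `n = |G ∖ K|` (closed form `genSum_eq` in `Night2PartialCells`).  At `q = 5`:
`(3, 2)` with `m₁ = 5`, `(2, 1)` with `m₁ = 7`, `(2, 0)` with `m₁ = 6` (`Night2PartialCells`).
-/

namespace PercRepro.Shadow

open Finset PerFlat ThmH

/-- The request bound of the non-basis members under `m₁`-partial spread: `R₁ = Φ/(m₁ + d)`. -/
noncomputable def reqDGP (q d m₁ : ℕ) : ℚ := phiQ q / ((m₁ : ℚ) + (d : ℚ))

/-- `cPrimeDGP = capDG − (ρ − 2) R₁`. -/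
noncomputable def cPrimeDGP (q d ρ k m₁ : ℕ) : ℚ := capDG q d k - ((ρ : ℚ) - 2) * reqDGP q d m₁

namespace DGenP

/-- The coefficient of the targets of size `ρ + j`: `c′` in the middle, `1` at the top `t` levels. -/
noncomputable def cjG (n ρ t j : ℕ) (c' : ℚ) : ℚ := if j + ρ + t ≤ n then c' else 1

/-- The generic target sum with constants `c′`, `λ`. -/
noncomputable def genSum (n ρ t : ℕ) (c' lam : ℚ) : ℚ :=
  ∑ j ∈ Finset.Icc 1 (n - ρ), ((n - ρ).choose j : ℚ) * (cjG n ρ t j c' / ((ρ : ℚ) * lam * ((j + ρ).choose ρ : ℚ)))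

end DGenP

variable {α : Type*} [DecidableEq α] {M : Matroid α} [M.Finite]

/-- `reqDGP > 0` when `1 ≤ d`. -/
theorem reqDGP_pos {q d m₁ : ℕ} (hd : 1 ≤ d) : 0 < reqDGP q d m₁ := by
  unfold reqDGP
  have : (1 : ℚ) ≤ (d : ℚ) := by exact_mod_cast hd
  exact div_pos (phiQ_pos q) (by positivity)

open scoped Classical in
/-- Under `m₁`-partial spread, `L1 S ≤ (ρ − 2) R₁` at a shadow set with `|S ∖ K| ≥ ρ + 1`: its thin covering
preimages are non-basis members. -/
theorem L1_le_of_card_ge_dgenP {q d ρ m₁ : ℕ} {G : Finset α} (hG : G ∈ flatsQ M (q + 1))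
    (hd : (gr M \ G).card = d) (hdq : d ≤ q) (hk : kColoops M G + ρ = q + 1)
    (hs : ∀ e ∈ gr M, ∀ f ∈ gr M, e ≠ f → rkN M {e, f} = 2) (hl : ∀ e ∈ gr M, M.Indep {e})
    (hm₁ : ∀ B ∈ thinMembers M q G, ρ ≤ (B \ coloops M G).card → m₁ ≤ (G \ clF M B).card) {S : Finset α}
    (hS : S ∈ shadowAt M (q + 2) q (Uq M (q + 2) q) G) (hcard : ρ + 1 ≤ (S \ coloops M G).card) :
    L1 M q G S ≤ ((ρ : ℚ) - 2) * reqDGP q d m₁ := by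
  have hd' : (gr M \ G).card ≤ q := by omega
  have hKS : coloops M G ⊆ S := coloops_subset_of_mem_shadowAt hS
  unfold L1
  have hterm : ∀ B ∈ (coverPreimages M (Uq M (q + 2) q) G S).filter (fun B => B ∉ lay0 M q G),
      req M q B ≤ reqDGP q d m₁ := by
    intro B hB
    have hBi := thin_coverPreimages_subset_image_coloops hG hd' S hB
    rw [Finset.mem_image] at hBi
    obtain ⟨w, hw, rfl⟩ := hBi
    rw [Finset.mem_filter, mem_coverPreimages] at hB
    have hBt : S.erase w ∈ thinMembers M q G := mem_thinMembers.2 ⟨hB.1.1, hB.2⟩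
    have hwS : w ∈ S \ coloops M G := (mem_coloops.1 hw).1
    -- |(S ∖ w) ∖ K| = |S ∖ K| − 1 ≥ ρ
    have hcard' : ρ ≤ ((S.erase w) \ coloops M G).card := by
      have e : (S.erase w) \ coloops M G = (S \ coloops M G).erase w := by
        ext x; simp only [Finset.mem_sdiff, Finset.mem_erase]; tauto
      rw [e, Finset.card_erase_of_mem hwS]; omega
    unfold reqDGP
    exact req_le_of_spread hG hd hBt (hm₁ _ hBt hcard')
  have hcount := card_thin_coverPreimages_add_two_le hG hd' hk hs hl hS hcard
  calc ∑ B ∈ (coverPreimages M (Uq M (q + 2) q) G S).filter (fun B => B ∉ lay0 M q G), req M q B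
      ≤ ∑ _B ∈ (coverPreimages M (Uq M (q + 2) q) G S).filter (fun B => B ∉ lay0 M q G), reqDGP q d m₁ :=
        Finset.sum_le_sum hterm
    _ = (((coverPreimages M (Uq M (q + 2) q) G S).filter (fun B => B ∉ lay0 M q G)).card : ℚ) * reqDGP q d m₁ := by
        rw [Finset.sum_const, nsmul_eq_mul]
    _ ≤ ((ρ : ℚ) - 2) * reqDGP q d m₁ := by
        have hd1 : 1 ≤ d := by
          obtain ⟨B, hB⟩ := (mem_shadow.1 (mem_shadowAt.1 hS).1).2
          rw [← hd]; exact one_le_card_compl_of_member hG hB.1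
        apply mul_le_mul_of_nonneg_right _ (reqDGP_pos hd1).le
        have : (((coverPreimages M (Uq M (q + 2) q) G S).filter (fun B => B ∉ lay0 M q G)).card : ℚ) + 2 ≤
            (ρ : ℚ) := by exact_mod_cast hcount
        linarith

open scoped Classical in
/-- **Partial spread: a thin member with `|B ∖ K| ≥ ρ` loses nothing** (`0 ≤ cPrimeDGP`). -/
theorem loss_eq_zero_of_card_ge_dgenP {q d ρ m₁ : ℕ} {G : Finset α} (hG : G ∈ flatsQ M (q + 1))
    (hd : (gr M \ G).card = d) (hdq : d ≤ q) (hk : kColoops M G + ρ = q + 1)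
    (hc : 0 ≤ cPrimeDGP q d ρ (kColoops M G) m₁)
    (hs : ∀ e ∈ gr M, ∀ f ∈ gr M, e ≠ f → rkN M {e, f} = 2) (hl : ∀ e ∈ gr M, M.Indep {e})
    (hm₁ : ∀ B ∈ thinMembers M q G, ρ ≤ (B \ coloops M G).card → m₁ ≤ (G \ clF M B).card)
    {B : Finset α} (hB : B ∈ thinMembers M q G) (hcard : ρ ≤ (B \ coloops M G).card) {z : α}
    (hz : z ∈ G \ clF M B) : loss M q G B z = 0 := by
  have hd' : (gr M \ G).card ≤ q := by omega
  have hSsh := insert_mem_shadowAt_thin hG hB hz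
  have hSG : insert z B ⊆ G := subset_G_of_mem_shadowAt hSsh
  have hL : L1 M q G (insert z B) ≤ capS M q G (insert z B) := by
    have h1 := L1_le_of_card_ge_dgenP hG hd hdq hk hs hl hm₁ hSsh
      (by rw [card_insert_sdiff_coloops_thin hG hd' hB hz]; omega)
    have h2 := capS_ge_one_sub_kColoops (q := q) hd hSG
    unfold cPrimeDGP capDG at hc
    linarith
  unfold loss fS
  rw [if_pos hL]
  ring

open scoped Classical in
/-- A loss pair with positive weight is a hyperplane-basis member (partial spread). -/
theorem card_sdiff_add_one_eq_of_rhoL_ne_zero_dgenP {q d ρ m₁ : ℕ} {G : Finset α} (hG : G ∈ flatsQ M (q + 1))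
    (hd : (gr M \ G).card = d) (hdq : d ≤ q) (hk : kColoops M G + ρ = q + 1)
    (hc : 0 ≤ cPrimeDGP q d ρ (kColoops M G) m₁)
    (hs : ∀ e ∈ gr M, ∀ f ∈ gr M, e ≠ f → rkN M {e, f} = 2) (hl : ∀ e ∈ gr M, M.Indep {e})
    (hm₁ : ∀ B ∈ thinMembers M q G, ρ ≤ (B \ coloops M G).card → m₁ ≤ (G \ clF M B).card)
    {B : Finset α} (hB : B ∈ thinMembers M q G) {z : α} (hz : z ∈ G \ clF M B)
    (hρ' : rhoL M q G B z ≠ 0) : (B \ coloops M G).card + 1 = ρ := by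
  have hd' : (gr M \ G).card ≤ q := by omega
  have hloss : loss M q G B z ≠ 0 := by
    intro h; apply hρ'; unfold rhoL; rw [h, zero_div]
  have hge := card_sdiff_coloops_thin_ge hG hd' hk hB
  by_contra hne
  exact hloss (loss_eq_zero_of_card_ge_dgenP hG hd hdq hk hc hs hl hm₁ hB (by omega) hz)

open scoped Classical in
/-- **The loss mass of a shadow set is at most `ρ C(|S ∖ K|, ρ) λ/(2^{n−ρ} − 1)`** (partial spread). -/
theorem pi2Mass_le_dgenP {q d ρ m₁ : ℕ} {G : Finset α} (hG : G ∈ flatsQ M (q + 1)) (hd : (gr M \ G).card = d)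
    (hdq : d ≤ q) (hk : kColoops M G + ρ = q + 1) (hkd : kColoops M G + 1 ≤ d) (hρ : 1 ≤ ρ)
    (hc : 0 ≤ cPrimeDGP q d ρ (kColoops M G) m₁) (hlam : 0 ≤ lambdaDG q d ρ (kColoops M G))
    (hs : ∀ e ∈ gr M, ∀ f ∈ gr M, e ≠ f → rkN M {e, f} = 2) (hl : ∀ e ∈ gr M, M.Indep {e})
    (hm₁ : ∀ B ∈ thinMembers M q G, ρ ≤ (B \ coloops M G).card → m₁ ≤ (G \ clF M B).card)
    (S : Finset α) :
    pi2Mass M q G S ≤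
      ((ρ : ℚ) * ((S \ coloops M G).card.choose ρ : ℚ)) *
        (lambdaDG q d ρ (kColoops M G) / ((2 ^ ((G.card - kColoops M G) - ρ) - 1 : ℕ) : ℚ)) := by
  have hd' : (gr M \ G).card ≤ q := by omega
  rw [pi2Mass_eq_sum_lossPairsAt]
  set r := (G.card - kColoops M G) - ρ with hr
  set w : ℚ := lambdaDG q d ρ (kColoops M G) / ((2 ^ r - 1 : ℕ) : ℚ) with hw
  have hw0 : 0 ≤ w := by rw [hw]; exact div_nonneg hlam (by positivity)
  have hterm : ∀ p ∈ lossPairsAt M q G S, rhoL M q G p.1 p.2 ≤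
      if rhoL M q G p.1 p.2 = 0 then 0 else w := by
    intro p hp
    split_ifs with h0
    · rw [h0]
    · unfold lossPairsAt at hp
      rw [Finset.mem_filter, Finset.mem_image] at hp
      obtain ⟨⟨x, hx, rfl⟩, hpS⟩ := hp
      rw [Finset.mem_sigma] at hx
      obtain ⟨hB, hz⟩ := hx
      have h2 := card_sdiff_add_one_eq_of_rhoL_ne_zero_dgenP hG hd hdq hk hc hs hl hm₁ hB hz h0
      unfold rhoL
      rw [card_tgtSets hG (mem_thinMembers.1 hB).1 hz, card_sdiff_insert_eq_dqm1 hG hd' hB h2 hz, ← hr, hw]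
      apply div_le_div_of_nonneg_right _ (by positivity)
      exact loss_le_lambdaDG hG hd hdq hkd hρ hB h2 hz hlam
  calc ∑ p ∈ lossPairsAt M q G S, rhoL M q G p.1 p.2
      ≤ ∑ p ∈ lossPairsAt M q G S, (if rhoL M q G p.1 p.2 = 0 then 0 else w) := Finset.sum_le_sum hterm
    _ = ((lossPairsAt M q G S).filter (fun p => rhoL M q G p.1 p.2 ≠ 0)).card * w := by
        rw [Finset.sum_ite, Finset.sum_const_zero, zero_add, Finset.sum_const, nsmul_eq_mul]
    _ ≤ ((ρ : ℚ) * ((S \ coloops M G).card.choose ρ : ℚ)) * w := by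
        apply mul_le_mul_of_nonneg_right _ hw0
        have hinj : ((lossPairsAt M q G S).filter (fun p => rhoL M q G p.1 p.2 ≠ 0)).card ≤
            (((S \ coloops M G).powersetCard ρ).sigma (fun T => T)).card := by
          apply Finset.card_le_card_of_injOn (fun p => ⟨insert p.2 (p.1 \ coloops M G), p.2⟩)
          · intro p hp
            rw [Finset.mem_coe, Finset.mem_filter] at hp
            obtain ⟨hp, hρ'⟩ := hp
            unfold lossPairsAt at hp
            rw [Finset.mem_filter, Finset.mem_image] at hp
            obtain ⟨⟨x, hx, rfl⟩, hpS⟩ := hp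
            rw [Finset.mem_sigma] at hx
            obtain ⟨hB, hz⟩ := hx
            have h2 := card_sdiff_add_one_eq_of_rhoL_ne_zero_dgenP hG hd hdq hk hc hs hl hm₁ hB hz hρ'
            have hB' : x.1 ∈ membersIn M (Uq M (q + 2) q) G := (mem_thinMembers.1 hB).1
            have hBU : x.1 ∈ Uq M (q + 2) q := (mem_membersIn.1 hB').1
            have hzB : x.2 ∉ x.1 := notMem_of_notMem_clF hBU (Finset.mem_sdiff.1 hz).2
            have hzK : x.2 ∉ x.1 \ coloops M G := fun hh => hzB (Finset.mem_sdiff.1 hh).1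
            have hsub : insert x.2 x.1 ⊆ S := (mem_tgtSets.1 hpS).2.1
            rw [Finset.mem_coe, Finset.mem_sigma, Finset.mem_powersetCard]
            refine ⟨⟨?_, ?_⟩, Finset.mem_insert_self _ _⟩
            · intro y hy
              rw [Finset.mem_insert] at hy
              rw [Finset.mem_sdiff]
              rcases hy with rfl | hy
              · refine ⟨hsub (Finset.mem_insert_self _ _), ?_⟩
                intro hzc
                exact hzB (coloops_subset_of_mem_thinMembers hG hd' hB hzc)
              · rw [Finset.mem_sdiff] at hy
                exact ⟨hsub (Finset.mem_insert_of_mem hy.1), hy.2⟩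
            · rw [Finset.card_insert_of_notMem hzK, h2]
          · intro p hp p' hp' heq
            rw [Finset.mem_coe, Finset.mem_filter] at hp hp'
            obtain ⟨hp, -⟩ := hp
            obtain ⟨hp', -⟩ := hp'
            unfold lossPairsAt at hp hp'
            rw [Finset.mem_filter, Finset.mem_image] at hp hp'
            obtain ⟨⟨x, hx, rfl⟩, -⟩ := hp
            obtain ⟨⟨x', hx', rfl⟩, -⟩ := hp'
            rw [Finset.mem_sigma] at hx hx'
            simp only [Sigma.mk.injEq] at heq
            obtain ⟨hT, hzz⟩ := heq
            have hzz' : x.2 = x'.2 := eq_of_heq hzz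
            have hBU : x.1 ∈ Uq M (q + 2) q := (mem_membersIn.1 (mem_thinMembers.1 hx.1).1).1
            have hBU' : x'.1 ∈ Uq M (q + 2) q := (mem_membersIn.1 (mem_thinMembers.1 hx'.1).1).1
            have hB := lossPairs_inj hG hd' hx.1 hx'.1 hT hzz'
              (notMem_of_notMem_clF hBU (Finset.mem_sdiff.1 hx.2).2)
              (notMem_of_notMem_clF hBU' (Finset.mem_sdiff.1 hx'.2).2)
            exact Prod.ext hB hzz'
        have hcount : (((S \ coloops M G).powersetCard ρ).sigma (fun T => T)).card =
            ρ * (S \ coloops M G).card.choose ρ := by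
          rw [Finset.card_sigma]
          have : ∀ T ∈ (S \ coloops M G).powersetCard ρ, T.card = ρ :=
            fun T hT => (Finset.mem_powersetCard.1 hT).2
          rw [Finset.sum_congr rfl this, Finset.sum_const, Finset.card_powersetCard, smul_eq_mul, mul_comm]
        have := hinj.trans hcount.le
        exact_mod_cast this

open scoped Classical in
/-- **`cap2 S ≥ c′` at every shadow set with `|S ∖ K| ≥ ρ + 1`** (partial spread). -/
theorem cap2_ge_cPrimeDGP {q d ρ m₁ : ℕ} {G : Finset α} (hG : G ∈ flatsQ M (q + 1))
    (hd : (gr M \ G).card = d) (hdq : d ≤ q) (hk : kColoops M G + ρ = q + 1)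
    (hs : ∀ e ∈ gr M, ∀ f ∈ gr M, e ≠ f → rkN M {e, f} = 2) (hl : ∀ e ∈ gr M, M.Indep {e})
    (hm₁ : ∀ B ∈ thinMembers M q G, ρ ≤ (B \ coloops M G).card → m₁ ≤ (G \ clF M B).card) {S : Finset α}
    (hS : S ∈ shadowAt M (q + 2) q (Uq M (q + 2) q) G) (hcard : ρ + 1 ≤ (S \ coloops M G).card) :
    cPrimeDGP q d ρ (kColoops M G) m₁ ≤ cap2 M q G S := by
  have hd' : (gr M \ G).card ≤ q := by omega
  unfold cPrimeDGP
  have h1 := cap2_ge_capS_sub_L1_of_le hG hd' S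
  have h2 := capS_ge_one_sub_kColoops (q := q) hd (subset_G_of_mem_shadowAt hS)
  have h3 := L1_le_of_card_ge_dgenP hG hd hdq hk hs hl hm₁ hS hcard
  unfold capDG
  linarith

open scoped Classical in
/-- **THE PARTIAL-SPREAD REGIME MODULO ITS TARGET SUM.** -/
theorem localShadowHall_dgenP_of_sum {q d ρ m₁ : ℕ} {G : Finset α} (hG : G ∈ flatsQ M (q + 1))
    (hd : (gr M \ G).card = d) (hdq : d ≤ q) (hk : kColoops M G + ρ = q + 1) (hρ : 3 ≤ ρ)
    (hkd : kColoops M G + 1 ≤ d) (hs : ∀ e ∈ gr M, ∀ f ∈ gr M, e ≠ f → rkN M {e, f} = 2)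
    (hl : ∀ e ∈ gr M, M.Indep {e}) (hc : 0 ≤ cPrimeDGP q d ρ (kColoops M G) m₁)
    (hlam : 0 < lambdaDG q d ρ (kColoops M G))
    (hm₁ : ∀ B ∈ thinMembers M q G, ρ ≤ (B \ coloops M G).card → m₁ ≤ (G \ clF M B).card)
    (hsum : 1 ≤ DGenP.genSum (G.card - kColoops M G) ρ (q - d + 1) (cPrimeDGP q d ρ (kColoops M G) m₁)
      (lambdaDG q d ρ (kColoops M G))) : LocalShadowHall M q G := by
  have hd' : (gr M \ G).card ≤ q := by omega
  apply localShadowHall_of_lossFair hG hd'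
  intro B hB z hz
  by_cases hl0 : loss M q G B z = 0
  · rw [hl0]
    exact mul_nonneg (rhoL_nonneg hG hd' B z) (lossIncome_nonneg hG hd' B z)
  have hB' : B ∈ membersIn M (Uq M (q + 2) q) G := (mem_thinMembers.1 hB).1
  have hBU : B ∈ Uq M (q + 2) q := (mem_membersIn.1 hB').1
  have hzB : z ∉ B := notMem_of_notMem_clF hBU (Finset.mem_sdiff.1 hz).2
  have hK := coloops_subset_of_mem_thinMembers hG hd' hB
  have h2 : (B \ coloops M G).card + 1 = ρ := by
    by_contra hne
    have hge := card_sdiff_coloops_thin_ge hG hd' hk hB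
    exact hl0 (loss_eq_zero_of_card_ge_dgenP hG hd hdq hk hc hs hl hm₁ hB (by omega) hz)
  set n := G.card - kColoops M G with hn
  have hr : (G \ insert z B).card = n - ρ := card_sdiff_insert_eq_dqm1 hG hd' hB h2 hz
  have hr1 : 1 ≤ n - ρ := by rw [← hr]; exact one_le_card_sdiff_insert hG hd' hB hz
  have hBcard : B.card = kColoops M G + (B \ coloops M G).card := by
    rw [kColoops_eq_card_coloops, ← Finset.card_union_of_disjoint Finset.disjoint_sdiff,
      Finset.union_sdiff_of_subset hK]
  have hb : (insert z B).card = q + 1 := by rw [Finset.card_insert_of_notMem hzB, hBcard]; omega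
  have hT : (tgtSets M q G B z).card = 2 ^ (n - ρ) - 1 := by rw [card_tgtSets hG hB' hz, hr]
  have hTpos : (0 : ℚ) < ((2 ^ (n - ρ) - 1 : ℕ) : ℚ) := by
    have : 2 ≤ 2 ^ (n - ρ) := by
      calc 2 = 2 ^ 1 := by norm_num
        _ ≤ 2 ^ (n - ρ) := Nat.pow_le_pow_right (by norm_num) hr1
    exact_mod_cast (by omega : 0 < 2 ^ (n - ρ) - 1)
  have hGcard : G.card = n + kColoops M G := by
    have : kColoops M G ≤ G.card := by
      rw [kColoops_eq_card_coloops]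
      exact Finset.card_le_card (hK.trans ((subset_clF hBU).trans (mem_membersIn.1 hB').2))
    omega
  -- the size bounds on the targets
  set u : ℕ → ℚ := fun s => ((ρ : ℚ) * ((s - kColoops M G).choose ρ : ℚ)) *
    (lambdaDG q d ρ (kColoops M G) / ((2 ^ (n - ρ) - 1 : ℕ) : ℚ)) with hu_def
  set v : ℕ → ℚ := fun s => if s + (q - d + 1) ≤ G.card then cPrimeDGP q d ρ (kColoops M G) m₁ else 1 with hv_def
  have hKS : ∀ S ∈ tgtSets M q G B z, coloops M G ⊆ S :=
    fun S hS => coloops_subset_of_mem_shadowAt (mem_tgtSets.1 hS).1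
  have hSK : ∀ S ∈ tgtSets M q G B z, (S \ coloops M G).card = S.card - kColoops M G := by
    intro S hS
    rw [Finset.card_sdiff_of_subset (hKS S hS), kColoops_eq_card_coloops]
  have hρ1 : ∀ S ∈ tgtSets M q G B z, ρ + 1 ≤ (S \ coloops M G).card := by
    intro S hS
    obtain ⟨-, hBS, hcard⟩ := mem_tgtSets.1 hS
    have hBS' : B ⊆ S := (Finset.subset_insert z B).trans hBS
    have hsub : (S \ B) ∪ (B \ coloops M G) ⊆ S \ coloops M G := by
      intro x hx
      rw [Finset.mem_union, Finset.mem_sdiff, Finset.mem_sdiff] at hx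
      rw [Finset.mem_sdiff]
      rcases hx with ⟨hxS, hxB⟩ | ⟨hxB, hxK⟩
      · exact ⟨hxS, fun h => hxB (hK h)⟩
      · exact ⟨hBS' hxB, hxK⟩
    have hdisj : Disjoint (S \ B) (B \ coloops M G) := by
      rw [Finset.disjoint_left]; intro x hx hx'
      exact (Finset.mem_sdiff.1 hx).2 (Finset.mem_sdiff.1 hx').1
    have := Finset.card_le_card hsub
    rw [Finset.card_union_of_disjoint hdisj] at this
    omega
  have hu : ∀ S ∈ tgtSets M q G B z, pi2Mass M q G S ≤ u S.card := by
    intro S hS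
    have := pi2Mass_le_dgenP hG hd hdq hk hkd (by omega) hc hlam.le hs hl hm₁ S
    rw [hSK S hS] at this
    simpa [hu_def, hn] using this
  have hv : ∀ S ∈ tgtSets M q G B z, v S.card ≤ cap2 M q G S := by
    intro S hS
    have hS' := (mem_tgtSets.1 hS).1
    have hSG : S ⊆ G := subset_G_of_mem_shadowAt hS'
    simp only [hv_def]
    split_ifs with hle
    · exact cap2_ge_cPrimeDGP hG hd hdq hk hs hl hm₁ hS' (hρ1 S hS)
    · push Not at hle
      have h1 : (G \ S).card ≤ q - d := by
        rw [Finset.card_sdiff_of_subset hSG]; omega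
      exact (cap2_eq_one_of_card_le hG (by rw [hd]; omega)).ge
  have hv0 : ∀ S ∈ tgtSets M q G B z, 0 ≤ v S.card := by
    intro S _
    simp only [hv_def]
    split_ifs
    · exact hc
    · exact zero_le_one
  have hinc := lossIncome_ge_of_bounds hG hd' hB hz hl0 u v hu hv hv0
  rw [hr, hb] at hinc
  have hsum' : ∑ j ∈ Finset.Icc 1 (n - ρ), ((n - ρ).choose j : ℚ) * (v (q + 1 + j) / u (q + 1 + j)) =
      ((2 ^ (n - ρ) - 1 : ℕ) : ℚ) * DGenP.genSum n ρ (q - d + 1) (cPrimeDGP q d ρ (kColoops M G) m₁)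
        (lambdaDG q d ρ (kColoops M G)) := by
    unfold DGenP.genSum
    rw [Finset.mul_sum]
    apply Finset.sum_congr rfl
    intro j hj
    rw [Finset.mem_Icc] at hj
    have hv' : v (q + 1 + j) = DGenP.cjG n ρ (q - d + 1) j (cPrimeDGP q d ρ (kColoops M G) m₁) := by
      simp only [hv_def, DGenP.cjG]
      have hiff : q + 1 + j + (q - d + 1) ≤ G.card ↔ j + ρ + (q - d + 1) ≤ n := by omega
      by_cases hcj : j + ρ + (q - d + 1) ≤ n
      · rw [if_pos (hiff.2 hcj), if_pos hcj]
      · rw [if_neg (fun h => hcj (hiff.1 h)), if_neg hcj]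
    have hu' : u (q + 1 + j) = ((ρ : ℚ) * ((j + ρ).choose ρ : ℚ)) *
        (lambdaDG q d ρ (kColoops M G) / ((2 ^ (n - ρ) - 1 : ℕ) : ℚ)) := by
      simp only [hu_def]
      rw [show q + 1 + j - kColoops M G = j + ρ by omega]
    rw [hv', hu']
    have hjρ : (0 : ℚ) < ((j + ρ).choose ρ : ℚ) := by exact_mod_cast Nat.choose_pos (by omega)
    have hρ0 : (0 : ℚ) < (ρ : ℚ) := by exact_mod_cast (by omega : 0 < ρ)
    field_simp
  rw [hsum'] at hinc
  unfold rhoL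
  rw [hT]
  have hl' : 0 < loss M q G B z := lt_of_le_of_ne (loss_nonneg' hG hd' B z) (Ne.symm hl0)
  calc loss M q G B z = loss M q G B z / ((2 ^ (n - ρ) - 1 : ℕ) : ℚ) * ((2 ^ (n - ρ) - 1 : ℕ) : ℚ) := by
        field_simp
    _ ≤ loss M q G B z / ((2 ^ (n - ρ) - 1 : ℕ) : ℚ) *
          (((2 ^ (n - ρ) - 1 : ℕ) : ℚ) * DGenP.genSum n ρ (q - d + 1) (cPrimeDGP q d ρ (kColoops M G) m₁)
            (lambdaDG q d ρ (kColoops M G))) := by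
        apply mul_le_mul_of_nonneg_left _ (div_nonneg hl'.le hTpos.le)
        nlinarith [hsum, hTpos]
    _ ≤ loss M q G B z / ((2 ^ (n - ρ) - 1 : ℕ) : ℚ) * lossIncome M q G B z :=
        mul_le_mul_of_nonneg_left hinc (div_nonneg hl'.le hTpos.le)

end PercRepro.Shadow
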